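import Summits.QuantumFields.YangMills.Theorems.F4SubCurvatureDoorLaplaceFourierRegistered
import Summits.QuantumFields.YangMills.Theorems.F4SubCurvatureDoorFibreDichotomyAxisRungs
import Summits.QuantumFields.YangMills.Theorems.F4SubCurvatureDoorRationalToGeneralCrossAnalyticity
import Summits.QuantumFields.YangMills.Theorems.F4SubCurvatureDoorRationalToGeneralLaplacianMultiplier
import Literature.Analysis.Complex.HolomorphicParametricIntegral
import Literature.NumberTheory.LFunctions.DeBruijnNewmanProofs
import Mathlib
import HarnessLib

/-!
# LINE g21-B «fibre dichotomy» (⟨stmt-QuantumFields-23125⟩) — analytic core of rung R-B4e `MirrorPatching`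

Owner file `Cruxes/RationalToGeneral/Lines/fibre_dichotomy_rungs.lean` v2 (ns `…FibreDichotomyRungs`).  R-B4e `MirrorPatching` asks for a `C²`,
`D₄`-invariant, Helmholtz patching of the symmetric one-sided transform `lfEval ν` of a shell measure.  This helper file supplies its ANALYTIC CORE:
`massSq` / `IsShellMeasure` restated CHARACTER-IDENTICALLY (the vocabulary `spacePart`, `lfEval`, `signIso` is the tree's, ns
`…F4SubCurvatureDoorFibreDichotomyAxis`), and

* `analyticAt_lfEval` — for a shell measure `ν`, `lfEval ν` is real-analytic (hence `C^∞`, `contDiffAt_lfEval`) at every point with `x₀ ≠ 0`.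

PROOF.  At `u` with `u₀ > 0` feed the landed cross theorem `crossAnalyticity_holds` (R-S1×, p717857) with the coordinate frame, radius and
neighbourhood `u₀/4` and the uniform bound `∫ e^{−(u₀/2)E} dν`: along `e₀` the extension is the dominated holomorphic Laplace integral
`w ↦ ∫ e^{−(t+w)E} cos⟪q⃗, z⃗⟫ dν`; along `e_{j+1}` it is `w ↦ ∫ e^{−tE} cos(⟪q⃗, z⃗⟫ + w qⱼ) dν`, dominated because `|cos(θ + w qⱼ)| ≤ e^{|Im w| |qⱼ|}
≤ e^{|Im w| E}` on the forward cone `‖q⃗‖ ≤ E` (the tree's `Literature.NumberTheory.LFunctions.norm_cos_le_exp_abs_im`);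
continuity on the ball is dominated convergence.  Points with `u₀ < 0` follow by the time reflection
`signIso`, which leaves `lfEval` invariant.

HONEST LABEL: helper toward ONE rung of the OPEN line g21-B (the patching / Helmholtz / `D₄`-invariance half of R-B4e is NOT done here); B4, B5,
⟨23125⟩, ⟨23035⟩, R2d and the Yang–Mills mass gap remain OPEN; no summit is proved by a line.
-/

noncomputable section

open MeasureTheory Filter Topology Set Metric
open scoped BigOperators

namespace Summit.QuantumFields.YangMills.Theorems.F4SubCurvatureDoorShellLFAnalytic

open Summit.QuantumFields.YangMills.Theorems.F4SubCurvatureDoorLaplaceFourierRegistered (E4 E3 timeSpace)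
open Summit.QuantumFields.YangMills.Theorems.F4SubCurvatureDoorFibreDichotomyAxis (spacePart lfEval signIso signIso_apply)
open Summit.QuantumFields.YangMills.Theorems.F4SubCurvatureDoorLaplacianMultiplierRegistered (timeSpace_apply_zero
  timeSpace_apply_succ timeSpace_add_smul_zero timeSpace_add_smul_succ inner_add_smul_single)
open Summit.QuantumFields.YangMills.Theorems.F4SubCurvatureDoorCrossAnalyticityRegistered (crossAnalyticity_holds)
open Literature.NumberTheory.LFunctions (norm_cos_le_exp_abs_im)

/-- Squared mass `E² − |q⃗|²` (verbatim from `Lines/fibre_dichotomy.lean`). -/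
def massSq (p : ℝ × E3) : ℝ := p.1 ^ 2 - ‖p.2‖ ^ 2

/-- Shell measures (verbatim from `Lines/fibre_dichotomy.lean`). -/
def IsShellMeasure (ν : Measure (ℝ × E3)) (s : ℝ) : Prop :=
  ν {p | p.1 < ‖p.2‖} = 0 ∧ ν {p | massSq p ≠ s} = 0 ∧
    ∀ t : ℝ, 0 < t → Integrable (fun p : ℝ × E3 => Real.exp (-(t * p.1))) ν

variable {ν : Measure (ℝ × E3)} {s : ℝ}

/-- A shell measure lives on the forward cone: `0 ≤ ‖q⃗‖ ≤ E` a.e. -/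
theorem IsShellMeasure.ae_cone (h : IsShellMeasure ν s) : ∀ᵐ p ∂ν, 0 ≤ p.1 ∧ ‖p.2‖ ≤ p.1 := by
  filter_upwards [measure_eq_zero_iff_ae_notMem.1 h.1] with p hp
  have h1 : ‖p.2‖ ≤ p.1 := not_lt.1 hp
  exact ⟨(norm_nonneg _).trans h1, h1⟩

/-! ## Coordinates -/

/-- Components of the spatial part. -/
theorem spacePart_apply (x : E4) (j : Fin 3) : spacePart x j = x j.succ := by
  simp [spacePart]

/-- `spacePart (timeSpace t z) = z`. -/
theorem spacePart_timeSpace (t : ℝ) (z : E3) : spacePart (timeSpace t z) = z := by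
  ext j
  rw [spacePart_apply, timeSpace_apply_succ]

/-- Every point is `timeSpace (x 0) (spacePart x)`. -/
theorem timeSpace_self (x : E4) : timeSpace (x 0) (spacePart x) = x := by
  ext k
  cases k using Fin.cases with
  | zero => rw [timeSpace_apply_zero]
  | succ j => rw [timeSpace_apply_succ, spacePart_apply]

/-- `spacePart` is continuous (it is linear on a finite-dimensional space). -/
theorem continuous_spacePart : Continuous (spacePart : E4 → E3) := by
  let L : E4 →ₗ[ℝ] E3 :=
    { toFun := spacePart
      map_add' := fun x y => by ext j; simp [spacePart_apply]
      map_smul' := fun c x => by ext j; simp [spacePart_apply] }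
  exact L.continuous_of_finiteDimensional

/-- The time coordinate is continuous. -/
theorem continuous_apply_zero : Continuous fun x : E4 => x 0 := by
  fun_prop

/-- `lfEval` in `timeSpace` coordinates. -/
theorem lfEval_timeSpace (t : ℝ) (z : E3) :
    lfEval ν (timeSpace t z) = ∫ p, Real.exp (-(|t| * p.1)) * Real.cos (inner ℝ p.2 z) ∂ν := by
  simp only [lfEval, timeSpace_apply_zero, spacePart_timeSpace]

/-- `|x₀ − u₀| ≤ dist x u`. -/
theorem abs_apply_zero_sub_le (x u : E4) : |x 0 - u 0| ≤ dist x u := by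
  rw [dist_eq_norm, ← Real.norm_eq_abs]
  simpa using PiLp.norm_apply_le (x - u) 0

/-! ## One-variable holomorphic extensions of `lfEval` along the coordinate axes -/

/-- TIME direction: `a ↦ lfEval ν (timeSpace t z + a e₀)` extends holomorphically to the disc of radius `r ≤ t − m` with bound `∫ e^{−mE} dν`. -/
theorem time_extension (h : IsShellMeasure ν s) {t r m : ℝ} (hm : 0 < m) (hmr : m ≤ t - r) (z : E3) :
    ∃ F : ℂ → ℂ, DifferentiableOn ℂ F (ball (0 : ℂ) r) ∧
      (∀ a : ℝ, |a| < r → F (a : ℂ) =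
        ((lfEval ν (timeSpace t z + a • EuclideanSpace.single (0 : Fin 4) (1 : ℝ)) : ℝ) : ℂ)) ∧
      ∀ w ∈ ball (0 : ℂ) r, ‖F w‖ ≤ ∫ p, Real.exp (-(m * p.1)) ∂ν := by
  set Fi : ℂ → ℝ × E3 → ℂ := fun w p =>
    Complex.exp (-(((t : ℂ) + w) * (p.1 : ℂ))) * ((Real.cos (inner ℝ p.2 z) : ℝ) : ℂ) with hFi
  have hFnorm : ∀ w p, ‖Fi w p‖ ≤ Real.exp (-((t + w.re) * p.1)) := by
    intro w p
    simp only [hFi, norm_mul, Complex.norm_exp, Complex.norm_real, Real.norm_eq_abs]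
    have hre : (-(((t : ℂ) + w) * (p.1 : ℂ))).re = -((t + w.re) * p.1) := by simp [Complex.mul_re]
    rw [hre]
    exact mul_le_of_le_one_right (Real.exp_pos _).le (Real.abs_cos_le_one _)
  have hdom : ∀ᵐ p ∂ν, ∀ w ∈ ball (0 : ℂ) r, ‖Fi w p‖ ≤ Real.exp (-(m * p.1)) := by
    filter_upwards [h.ae_cone] with p hp w hw
    rw [mem_ball_zero_iff] at hw
    have hre : |w.re| < r := lt_of_le_of_lt (Complex.abs_re_le_norm w) hw
    rw [abs_lt] at hre
    refine (hFnorm w p).trans (Real.exp_le_exp.2 ?_)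
    have : m ≤ t + w.re := by linarith
    nlinarith [hp.1]
  have hFcont : ∀ w, Continuous (Fi w) := fun w => by simp only [hFi]; fun_prop
  have hFdiff : ∀ p, Differentiable ℂ fun w => Fi w p := fun p => by simp only [hFi]; fun_prop
  have hr_of : ∀ w ∈ ball (0 : ℂ) r, m ≤ t + w.re := by
    intro w hw
    rw [mem_ball_zero_iff] at hw
    have hre : |w.re| < r := lt_of_le_of_lt (Complex.abs_re_le_norm w) hw
    rw [abs_lt] at hre
    linarith
  refine ⟨fun w => ∫ p, Fi w p ∂ν, ?_, ?_, ?_⟩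
  · refine Literature.Analysis.Complex.differentiableOn_integral_of_dominated
      (fun w _ => (hFcont w).aestronglyMeasurable) (Eventually.of_forall fun p => (hFdiff p).differentiableOn) ?_
    intro w₀ hw₀
    obtain ⟨ε, hε, hball⟩ := Metric.isOpen_iff.1 isOpen_ball w₀ hw₀
    refine ⟨ε, hε, hball, fun p => Real.exp (-(m * p.1)), h.2.2 m hm, ?_⟩
    filter_upwards [hdom] with p hp w hw
    exact hp w (hball hw)
  · intro a ha
    have hpos : 0 < t + a := by
      have := hr_of (a : ℂ) (by simpa using ha)
      simp only [Complex.ofReal_re] at this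
      linarith
    rw [timeSpace_add_smul_zero, lfEval_timeSpace, abs_of_pos hpos, ← integral_complex_ofReal]
    refine integral_congr_ae (ae_of_all _ fun p => ?_)
    simp only [hFi]
    push_cast
    ring_nf
  · intro w hw
    have hm' := hr_of w hw
    refine (norm_integral_le_integral_norm _).trans (integral_mono_of_nonneg (ae_of_all _ fun p => norm_nonneg _)
      (h.2.2 m hm) ?_)
    filter_upwards [hdom] with p hp
    exact hp w hw

/-- SPACE direction `j`: `a ↦ lfEval ν (timeSpace t z + a e_{j+1})` extends holomorphically to the disc of radius `r ≤ t − m` with bound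
`∫ e^{−mE} dν` (the imaginary shift costs `e^{|Im w| |qⱼ|} ≤ e^{r E}` on the forward cone). -/
theorem space_extension (h : IsShellMeasure ν s) {t r m : ℝ} (hm : 0 < m) (hmr : m ≤ t - r) (hr : 0 < r) (z : E3) (j : Fin 3) :
    ∃ F : ℂ → ℂ, DifferentiableOn ℂ F (ball (0 : ℂ) r) ∧
      (∀ a : ℝ, |a| < r → F (a : ℂ) =
        ((lfEval ν (timeSpace t z + a • EuclideanSpace.single j.succ (1 : ℝ)) : ℝ) : ℂ)) ∧
      ∀ w ∈ ball (0 : ℂ) r, ‖F w‖ ≤ ∫ p, Real.exp (-(m * p.1)) ∂ν := by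
  have ht : 0 < t := by linarith
  set Fi : ℂ → ℝ × E3 → ℂ := fun w p =>
    ((Real.exp (-(t * p.1)) : ℝ) : ℂ) * Complex.cos (((inner ℝ p.2 z : ℝ) : ℂ) + w * ((p.2 j : ℝ) : ℂ)) with hFi
  have hFnorm : ∀ w p, ‖Fi w p‖ ≤ Real.exp (-(t * p.1)) * Real.exp (|w.im| * |p.2 j|) := by
    intro w p
    simp only [hFi, norm_mul, Complex.norm_real, Real.norm_eq_abs, abs_of_pos (Real.exp_pos _)]
    refine mul_le_mul_of_nonneg_left ((norm_cos_le_exp_abs_im _).trans (le_of_eq ?_)) (Real.exp_pos _).le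
    congr 1
    simp [abs_mul]
  have hdom : ∀ᵐ p ∂ν, ∀ w ∈ ball (0 : ℂ) r, ‖Fi w p‖ ≤ Real.exp (-(m * p.1)) := by
    filter_upwards [h.ae_cone] with p hp w hw
    rw [mem_ball_zero_iff] at hw
    have him : |w.im| ≤ r := (Complex.abs_im_le_norm w).trans hw.le
    have hqj : |p.2 j| ≤ p.1 := by
      have := PiLp.norm_apply_le p.2 j
      rw [Real.norm_eq_abs] at this
      exact this.trans hp.2
    refine (hFnorm w p).trans ?_
    rw [← Real.exp_add]
    refine Real.exp_le_exp.2 ?_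
    have h1 : |w.im| * |p.2 j| ≤ r * p.1 := mul_le_mul him hqj (abs_nonneg _) hr.le
    nlinarith [hp.1]
  have hFcont : ∀ w, Continuous (Fi w) := fun w => by simp only [hFi]; fun_prop
  have hFdiff : ∀ p, Differentiable ℂ fun w => Fi w p := fun p => by simp only [hFi]; fun_prop
  refine ⟨fun w => ∫ p, Fi w p ∂ν, ?_, ?_, ?_⟩
  · refine Literature.Analysis.Complex.differentiableOn_integral_of_dominated
      (fun w _ => (hFcont w).aestronglyMeasurable) (Eventually.of_forall fun p => (hFdiff p).differentiableOn) ?_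
    intro w₀ hw₀
    obtain ⟨ε, hε, hball⟩ := Metric.isOpen_iff.1 isOpen_ball w₀ hw₀
    refine ⟨ε, hε, hball, fun p => Real.exp (-(m * p.1)), h.2.2 m hm, ?_⟩
    filter_upwards [hdom] with p hp w hw
    exact hp w (hball hw)
  · intro a _
    rw [timeSpace_add_smul_succ, lfEval_timeSpace, abs_of_pos ht, ← integral_complex_ofReal]
    refine integral_congr_ae (ae_of_all _ fun p => ?_)
    simp only [hFi, inner_add_smul_single]
    push_cast
    ring_nf
  · intro w hw
    refine (norm_integral_le_integral_norm _).trans (integral_mono_of_nonneg (ae_of_all _ fun p => norm_nonneg _)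
      (h.2.2 m hm) ?_)
    filter_upwards [hdom] with p hp
    exact hp w hw

/-! ## Continuity and analyticity -/

/-- `lfEval ν` is continuous on the ball of radius `u₀/4` about a point with `u₀ > 0`. -/
theorem continuousOn_lfEval (h : IsShellMeasure ν s) {u : E4} (hu : 0 < u 0) :
    ContinuousOn (lfEval ν) (ball u (u 0 / 4)) := by
  have hx0 : ∀ x ∈ ball u (u 0 / 4), u 0 / 2 ≤ |x 0| := by
    intro x hx
    have h1 := abs_apply_zero_sub_le x u
    rw [mem_ball] at hx
    have h2 : |x 0 - u 0| < u 0 / 4 := lt_of_le_of_lt h1 hx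
    rw [abs_lt] at h2
    rw [abs_of_pos (by linarith)]
    linarith
  refine continuousOn_of_dominated
    (F := fun (x : E4) (p : ℝ × E3) => Real.exp (-(|x 0| * p.1)) * Real.cos (inner ℝ p.2 (spacePart x)))
    (bound := fun p : ℝ × E3 => Real.exp (-(u 0 / 2 * p.1))) (fun x _ => ?_) (fun x hx => ?_) (h.2.2 _ (by linarith)) ?_
  · exact (Continuous.aestronglyMeasurable (by fun_prop))
  · filter_upwards [h.ae_cone] with p hp
    rw [norm_mul, Real.norm_eq_abs, Real.norm_eq_abs, abs_of_pos (Real.exp_pos _)]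
    refine (mul_le_of_le_one_right (Real.exp_pos _).le (Real.abs_cos_le_one _)).trans (Real.exp_le_exp.2 ?_)
    nlinarith [hx0 x hx, hp.1]
  · refine ae_of_all _ fun p => Continuous.continuousOn ?_
    have h1 : Continuous fun x : E4 => |x 0| := continuous_apply_zero.abs
    have h2 : Continuous fun x : E4 => inner ℝ p.2 (spacePart x) := continuous_const.inner continuous_spacePart
    fun_prop

/-- The coordinate frame is linearly independent. -/
theorem linearIndependent_single : LinearIndependent ℝ fun i : Fin 4 => EuclideanSpace.single i (1 : ℝ) := by
  have h := (EuclideanSpace.basisFun (Fin 4) ℝ).toBasis.linearIndependent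
  have e : ⇑(EuclideanSpace.basisFun (Fin 4) ℝ).toBasis = fun i : Fin 4 => EuclideanSpace.single i (1 : ℝ) := by
    funext i
    rw [OrthonormalBasis.coe_toBasis, EuclideanSpace.basisFun_apply]
  rw [e] at h
  exact h

/-- ANALYTICITY on the positive side: `lfEval ν` is real-analytic at every `u` with `u₀ > 0`. -/
theorem analyticAt_lfEval_pos (h : IsShellMeasure ν s) {u : E4} (hu : 0 < u 0) : AnalyticAt ℝ (lfEval ν) u := by
  refine crossAnalyticity_holds (lfEval ν) u _ linearIndependent_single (u 0 / 4) (∫ p, Real.exp (-(u 0 / 2 * p.1)) ∂ν)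
    (u 0 / 4) (by positivity) (by positivity) (continuousOn_lfEval h hu) ?_
  intro x hx j
  have h1 := abs_apply_zero_sub_le x u
  have h2 : |x 0 - u 0| < u 0 / 4 := lt_of_le_of_lt h1 hx
  rw [abs_lt] at h2
  obtain ⟨t, z, rfl⟩ : ∃ t z, x = timeSpace t z := ⟨x 0, spacePart x, (timeSpace_self x).symm⟩
  rw [timeSpace_apply_zero] at h2
  have hmr : u 0 / 2 ≤ t - u 0 / 4 := by linarith
  cases j using Fin.cases with
  | zero => exact time_extension h (by positivity) hmr z
  | succ j => exact space_extension h (by positivity) hmr (by positivity) z j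

/-- Time reflection leaves `lfEval` invariant. -/
theorem lfEval_timeReflection (x : E4) : lfEval ν (signIso ![false, true, true, true] x) = lfEval ν x := by
  have h0 : (signIso ![false, true, true, true] x) 0 = -x 0 := by
    rw [signIso_apply]; rfl
  have hsp : spacePart (signIso ![false, true, true, true] x) = spacePart x := by
    ext j
    rw [spacePart_apply, spacePart_apply, signIso_apply]
    have : (![false, true, true, true] : Fin 4 → Bool) j.succ = true := by
      fin_cases j <;> rfl
    rw [this]
    rfl
  simp only [lfEval, h0, hsp, abs_neg]

/-- **ANALYTIC CORE of R-B4e.** For a shell measure `ν`, `lfEval ν` is real-analytic at every point off the mirror `x₀ = 0`. -/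
theorem analyticAt_lfEval (h : IsShellMeasure ν s) {u : E4} (hu : u 0 ≠ 0) : AnalyticAt ℝ (lfEval ν) u := by
  rcases lt_or_gt_of_ne hu with hneg | hpos
  · have hT : lfEval ν = lfEval ν ∘ (signIso ![false, true, true, true]) :=
      funext fun x => (lfEval_timeReflection x).symm
    rw [hT]
    refine AnalyticAt.comp ?_ (((signIso ![false, true, true, true]).toContinuousLinearEquiv :
      E4 →L[ℝ] E4).analyticAt u)
    refine analyticAt_lfEval_pos h (u := signIso ![false, true, true, true] u) ?_
    show 0 < (signIso ![false, true, true, true] u) 0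
    rw [signIso_apply]
    show 0 < -u 0
    linarith
  · exact analyticAt_lfEval_pos h hpos

/-- Hence `lfEval ν` is `C²` (indeed `C^∞`) off the mirror. -/
theorem contDiffAt_lfEval (h : IsShellMeasure ν s) {u : E4} (hu : u 0 ≠ 0) : ContDiffAt ℝ 2 (lfEval ν) u :=
  (analyticAt_lfEval h hu).contDiffAt

end Summit.QuantumFields.YangMills.Theorems.F4SubCurvatureDoorShellLFAnalytic

end
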